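import Summits.ResolutionOfSingularities.ResolutionOfSingularities.Theorems.RadicialJungCleanModelsCleanSpreadsDualDerivations
import Summits.ResolutionOfSingularities.ResolutionOfSingularities.Theorems.RadicialJungCleanModelsCleanSpreadsRegularTypeMechanism
import Literature.AlgebraicGeometry.Resolution.DerivativeIdealsLocalization
import Literature.AlgebraicGeometry.Resolution.IdealsSpreadFromLocalization
import Summits.ResolutionOfSingularities.ResolutionOfSingularities.Theorems.RadicialJungCleanModelsStubExtendParameter
import HarnessLib

/-!
# Crux stmt-ResolutionOfSingularities-15917 (`RadicialJung.CleanModels`), stub `stub_cleanSpreads`,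
# part 4: nodal points are isolated

Support file for the stub `stub_cleanSpreads` (line `Sketch`, rev 7), **case (iv)**: on a finitely
generated `k`-domain `A` of characteristic `p` with `A_𝔭` regular of dimension `2` (`𝔭` maximal),
let `x = u f^e` be of nodal type at `𝔭`: `u ∉ 𝔭`, `p ∤ e`, `f ≡ c a₁ a₂ (mod 𝔪³)` with `c ∉ 𝔭`
and `(a₁, a₂)` a regular system of parameters of `A_𝔭`. With `E_1, E_2 ∈ Der(A)` dual to
`(a₁, a₂)` (`exists_derivations_dual_of_finiteType`): `E_j f ≡ c e a_{3-j}` and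
`G_j = f E_j u + e u E_j f ≡ e u c e a_{3-j} (mod 𝔪²)`, so `(E_1 f, E_2 f)` and `(G_1, G_2)`
contain `𝔪` (Nakayama, `maximalIdeal_le_span_pair`) and are contained in no other prime near `𝔭`
(`exists_notMem_forall_not_le`). At such a prime `𝔮 ∋ f`, `E_j f ∉ 𝔮` makes `f` a regular
parameter of `A_𝔮` and `x = u f^e` is toroidal with `m = 1`; at `𝔮 ∌ f`,
`f E_j(u f^e) = f^e G_j ∉ 𝔮` and `x` is of regular type (`spreads_of_nodal`).
-/

noncomputable section

set_option linter.dupNamespace false -- mandated namespace of this single-conjunct summit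

open IsLocalRing Literature.AlgebraicGeometry.Resolution

namespace Summit.ResolutionOfSingularities.ResolutionOfSingularities.Theorems.RadicialJung.CleanModels

universe u v w

/-! ## Nodal points are isolated -/

/-- **Spreading `𝔭 A_𝔭 ⊆ 𝔞 A_𝔭` off the closed point.** If `𝔭` is a finitely generated maximal
ideal and `𝔭 A_𝔭 ⊆ 𝔞 A_𝔭`, then for some `w ∉ 𝔭` no prime `𝔮 ≠ 𝔭` with `w ∉ 𝔮` contains `𝔞`
(each generator `z` of `𝔭` has `w_z z ∈ 𝔞` with `w_z ∉ 𝔭`; take `w = ∏ w_z`: then `𝔞 ⊆ 𝔮` forces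
`𝔭 ⊆ 𝔮`, i.e. `𝔮 = 𝔭`). -/
theorem exists_notMem_forall_not_le {A : Type u} [CommRing A] (𝔭 : Ideal A) [h𝔭 : 𝔭.IsMaximal]
    (O : Type v) [CommRing O] [Algebra A O] [IsLocalization.AtPrime O 𝔭] (h𝔭fg : 𝔭.FG)
    (𝔞 : Ideal A) (h : 𝔭.map (algebraMap A O) ≤ 𝔞.map (algebraMap A O)) :
    ∃ w : A, w ∉ 𝔭 ∧ ∀ (𝔮 : Ideal A) [𝔮.IsPrime], w ∉ 𝔮 → 𝔮 ≠ 𝔭 → ¬ 𝔞 ≤ 𝔮 := by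
  classical
  obtain ⟨s, hs⟩ := h𝔭fg
  have key : ∀ z ∈ s, ∃ w : A, w ∉ 𝔭 ∧ w * z ∈ 𝔞 := fun z hz =>
    exists_notMem_mul_mem_of_map_mem 𝔭
      (h (Ideal.mem_map_of_mem _ (hs ▸ Ideal.subset_span hz)))
  choose! w hw hwz using key
  refine ⟨∏ z ∈ s, w z, fun hmem => ?_, fun 𝔮 h𝔮 hq hne hle => hne ?_⟩
  · obtain ⟨z, hz, hz'⟩ := h𝔭.isPrime.prod_mem_iff.mp hmem
    exact hw z hz hz'
  · refine (h𝔭.eq_of_le h𝔮.ne_top ?_).symm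
    rw [← hs, Ideal.span_le]
    intro z hz
    have h1 : w z ∉ 𝔮 := fun h' => by
      obtain ⟨c, hc⟩ := Finset.dvd_prod_of_mem w hz
      exact hq (hc ▸ Ideal.mul_mem_right _ _ h')
    exact (h𝔮.mem_or_mem (hle (hwz z hz))).resolve_left h1

/-- A derivation maps `Q³` into `Q²` (Leibniz). -/
theorem derivation_apply_mem_sq_of_mem_cube {O : Type*} [CommRing O] (D : Derivation ℤ O O)
    (Q : Ideal O) {x : O} (hx : x ∈ Q ^ 3) : D x ∈ Q ^ 2 := by
  rw [(pow_succ Q 2 : Q ^ 3 = Q ^ 2 * Q)] at hx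
  refine Submodule.mul_induction_on hx (fun a ha b hb => ?_) (fun a b ha hb => ?_)
  · rw [Derivation.leibniz, smul_eq_mul, smul_eq_mul]
    refine Ideal.add_mem _ (Ideal.mul_mem_right _ _ ha) ?_
    rw [pow_two]
    exact Ideal.mul_mem_mul hb (derivation_apply_mem_of_mem_sq D Q ha)
  · rw [map_add]
    exact Ideal.add_mem _ ha hb

/-- **Nakayama for a pair.** In a Noetherian local ring with `𝔪 = (t₁, t₂)`, if
`g₁ ≡ μ t₂` and `g₂ ≡ μ t₁ (mod 𝔪²)` for a unit `μ`, then `𝔪 ⊆ (g₁, g₂)`. -/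
theorem maximalIdeal_le_span_pair {O : Type*} [CommRing O] [IsLocalRing O] [IsNoetherianRing O]
    {t₁ t₂ g₁ g₂ μ : O} (ht : Ideal.span {t₁, t₂} = maximalIdeal O) (hμ : IsUnit μ)
    (h₁ : g₁ - μ * t₂ ∈ maximalIdeal O ^ 2) (h₂ : g₂ - μ * t₁ ∈ maximalIdeal O ^ 2) :
    maximalIdeal O ≤ Ideal.span {g₁, g₂} := by
  have hfg : (maximalIdeal O).FG := (isNoetherian_def.mp inferInstance) _
  apply Submodule.le_of_le_smul_of_le_jacobson_bot hfg (IsLocalRing.maximalIdeal_le_jacobson ⊥)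
  rw [smul_eq_mul, ← pow_two]
  conv_lhs => rw [← ht]
  rw [Ideal.span_le, Set.insert_subset_iff, Set.singleton_subset_iff]
  constructor
  · have : t₁ = ↑hμ.unit⁻¹ * g₂ - ↑hμ.unit⁻¹ * (g₂ - μ * t₁) := by
      rw [mul_sub, sub_sub_cancel, ← mul_assoc, IsUnit.val_inv_mul, one_mul]
    rw [this]
    exact Ideal.sub_mem _ (Ideal.mem_sup_left (Ideal.mul_mem_left _ _ (Ideal.subset_span
      (Set.mem_insert_of_mem _ rfl)))) (Ideal.mem_sup_right (Ideal.mul_mem_left _ _ h₂))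
  · have : t₂ = ↑hμ.unit⁻¹ * g₁ - ↑hμ.unit⁻¹ * (g₁ - μ * t₂) := by
      rw [mul_sub, sub_sub_cancel, ← mul_assoc, IsUnit.val_inv_mul, one_mul]
    rw [this]
    exact Ideal.sub_mem _ (Ideal.mem_sup_left (Ideal.mul_mem_left _ _ (Ideal.subset_span
      (Set.mem_insert _ _)))) (Ideal.mem_sup_right (Ideal.mul_mem_left _ _ h₁))

/-- **Case (iv): `x = u f^e` of nodal type at `v`** (`f ≡ c a₁ a₂ (mod 𝔪_v³)`, `(a₁, a₂)` a regular
system of parameters, `dim 2`). With `E_1, E_2` dual to `(a₁, a₂)`: `E_j f ≡ c e a_{3-j}` and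
`G_j = f E_j u + e u E_j f ≡ e u c e a_{3-j} (mod 𝔪²)`, so `(E_1 f, E_2 f)` and `(G_1, G_2)` contain
`𝔪_v` (Nakayama) and are contained in no other prime near `𝔭` (`exists_notMem_forall_not_le`). At
such a prime `𝔮 ∋ f`, `E_j f ∉ 𝔮` makes `f` a regular parameter of `A_𝔮` and `x = u f^e` is toroidal
with `m = 1`; at `𝔮 ∌ f`, `f E_j(u f^e) = f^e G_j ∉ 𝔮` and `x` is of regular type. -/
theorem spreads_of_nodal (k : Type u) [Field k] (p : ℕ) (hp : p.Prime) {A : Type u}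
    [CommRing A] [IsDomain A] [CharP A p] [Algebra k A] [Algebra.FiniteType k A]
    {K : Type w} [CommRing K] [Algebra A K] (𝔭 : Ideal A) [h𝔭 : 𝔭.IsMaximal]
    (O : Type v) [CommRing O] [Algebra A O] [IsLocalization.AtPrime O 𝔭] [IsRegularLocalRing O]
    (x : K) (u f c a₁ a₂ : A) (e : ℕ) (hu : u ∉ 𝔭) (hc : c ∉ 𝔭) (he : ¬ p ∣ e)
    (ha : Ideal.span {algebraMap A O a₁, algebraMap A O a₂} = maximalIdeal O)
    (hd : ringKrullDim O = (2 : WithBot ℕ∞)) (hx : x = algebraMap A K (u * f ^ e))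
    (hf : algebraMap A O (f - c * a₁ * a₂) ∈ maximalIdeal O ^ 3) :
    ∃ h : A, h ∉ 𝔭 ∧ ∀ (𝔮 : Ideal A) [𝔮.IsPrime], h ∉ 𝔮 → 𝔮 ≠ 𝔭 →
      ∀ (O' : Type v) [CommRing O'] [Algebra A O'] [IsLocalization.AtPrime O' 𝔮]
        [IsRegularLocalRing O'] [Algebra O' K] [IsScalarTower A O' K],
      ((∃ (d m : ℕ) (hmd : m ≤ d) (t : Fin d → O') (a : Fin m → ℕ) (u : O'), IsUnit u ∧
          Ideal.span (Set.range t) = maximalIdeal O' ∧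
          ringKrullDim O' = (d : WithBot ℕ∞) ∧ 0 < m ∧ (∀ i, ¬ p ∣ a i) ∧
          x = algebraMap O' K (u * ∏ i : Fin m, t (Fin.castLE hmd i) ^ (a i))) ∨
        (∃ u : O', IsUnit u ∧ x = algebraMap O' K u ∧
          ∀ c' : O', u - c' ^ p ∉ maximalIdeal O') ∨
        (∃ s c' : O', x = algebraMap O' K s ∧
          s - c' ^ p ∈ maximalIdeal O' ∧ s - c' ^ p ∉ maximalIdeal O' ^ 2)) := by
  classical
  haveI : Fact p.Prime := ⟨hp⟩
  haveI : IsNoetherianRing A := Algebra.FiniteType.isNoetherianRing k A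
  -- the regular system of parameters `(a₁, a₂)` and its dual derivations
  let a : Fin 2 → A := ![a₁, a₂]
  have ha' : Ideal.span (Set.range fun i => algebraMap A O (a i)) = maximalIdeal O := by
    rw [← ha]
    congr 1
    ext z
    simp only [Set.mem_range, Set.mem_insert_iff, Set.mem_singleton_iff, Fin.exists_fin_two, a,
      Matrix.cons_val_zero, Matrix.cons_val_one]
    constructor
    · rintro (h | h)
      exacts [Or.inl h.symm, Or.inr h.symm]
    · rintro (h | h)
      exacts [Or.inl h.symm, Or.inr h.symm]
  have hd2 : ringKrullDim O = ((2 : ℕ) : WithBot ℕ∞) := hd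
  obtain ⟨E, ε, hε, hE⟩ := exists_derivations_dual_of_finiteType k 𝔭 O a ha' hd2
  have hE00 : E 0 a₁ = ε := by simpa [a] using hE 0 0
  have hE01 : E 0 a₂ = 0 := by simpa [a] using hE 0 1
  have hE10 : E 1 a₁ = 0 := by simpa [a] using hE 1 0
  have hE11 : E 1 a₂ = ε := by simpa [a] using hE 1 1
  obtain ⟨D₀, hD₀⟩ := exists_derivation_extend_of_isLocalization ℤ O 𝔭.primeCompl (E 0)
  obtain ⟨D₁, hD₁⟩ := exists_derivation_extend_of_isLocalization ℤ O 𝔭.primeCompl (E 1)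
  -- notation in `O`
  set t₁ : O := algebraMap A O a₁ with ht₁
  set t₂ : O := algebraMap A O a₂ with ht₂
  set fO : O := algebraMap A O f with hfO
  set cO : O := algebraMap A O c with hcO
  set uO : O := algebraMap A O u with huO
  set εO : O := algebraMap A O ε with hεO
  have ht₁m : t₁ ∈ maximalIdeal O := ha ▸ Ideal.subset_span (Set.mem_insert _ _)
  have ht₂m : t₂ ∈ maximalIdeal O := ha ▸ Ideal.subset_span (Set.mem_insert_of_mem _ rfl)
  have hεu : IsUnit εO := (IsLocalization.AtPrime.isUnit_to_map_iff O 𝔭 ε).mpr hε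
  have hcu : IsUnit cO := (IsLocalization.AtPrime.isUnit_to_map_iff O 𝔭 c).mpr hc
  have huu : IsUnit uO := (IsLocalization.AtPrime.isUnit_to_map_iff O 𝔭 u).mpr hu
  have heu : IsUnit ((e : ℕ) : O) := by
    have h := ((CharP.isUnit_natCast_iff (R := A) hp).mpr he).map (algebraMap A O)
    rwa [map_natCast] at h
  have hfO3 : fO - cO * t₁ * t₂ ∈ maximalIdeal O ^ 3 := by
    simpa only [map_sub, map_mul] using hf
  have ht12 : t₁ * t₂ ∈ maximalIdeal O ^ 2 := by
    rw [pow_two]; exact Ideal.mul_mem_mul ht₁m ht₂m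
  have hfO2 : fO ∈ maximalIdeal O ^ 2 := by
    have h1 : cO * t₁ * t₂ ∈ maximalIdeal O ^ 2 := by
      rw [mul_assoc]; exact Ideal.mul_mem_left _ _ ht12
    have h2 : fO - cO * t₁ * t₂ ∈ maximalIdeal O ^ 2 :=
      Ideal.pow_le_pow_right (by norm_num) hfO3
    simpa using Ideal.add_mem _ h2 h1
  -- the derivatives of `f` modulo `𝔪²`
  have hDt : D₀ t₁ = εO ∧ D₀ t₂ = 0 ∧ D₁ t₁ = 0 ∧ D₁ t₂ = εO := by
    refine ⟨?_, ?_, ?_, ?_⟩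
    · rw [ht₁, hD₀, hE00]
    · rw [ht₂, hD₀, hE01, map_zero]
    · rw [ht₁, hD₁, hE10, map_zero]
    · rw [ht₂, hD₁, hE11]
  have hDct : ∀ D : Derivation ℤ O O, D (cO * t₁ * t₂) =
      t₁ * t₂ * D cO + cO * t₂ * D t₁ + cO * t₁ * D t₂ := fun D => by
    rw [Derivation.leibniz, Derivation.leibniz]; simp only [smul_eq_mul]; ring
  have hD₀f : D₀ fO - cO * εO * t₂ ∈ maximalIdeal O ^ 2 := by
    have h1 : D₀ (fO - cO * t₁ * t₂) ∈ maximalIdeal O ^ 2 :=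
      derivation_apply_mem_sq_of_mem_cube D₀ _ hfO3
    rw [map_sub, hDct, hDt.1, hDt.2.1] at h1
    have : D₀ fO - cO * εO * t₂ =
        (D₀ fO - (t₁ * t₂ * D₀ cO + cO * t₂ * εO + cO * t₁ * 0)) + t₁ * t₂ * D₀ cO := by ring
    rw [this]
    exact Ideal.add_mem _ h1 (Ideal.mul_mem_right _ _ ht12)
  have hD₁f : D₁ fO - cO * εO * t₁ ∈ maximalIdeal O ^ 2 := by
    have h1 : D₁ (fO - cO * t₁ * t₂) ∈ maximalIdeal O ^ 2 :=
      derivation_apply_mem_sq_of_mem_cube D₁ _ hfO3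
    rw [map_sub, hDct, hDt.2.2.1, hDt.2.2.2] at h1
    have : D₁ fO - cO * εO * t₁ =
        (D₁ fO - (t₁ * t₂ * D₁ cO + cO * t₂ * 0 + cO * t₁ * εO)) + t₁ * t₂ * D₁ cO := by ring
    rw [this]
    exact Ideal.add_mem _ h1 (Ideal.mul_mem_right _ _ ht12)
  have hμ : IsUnit (cO * εO) := hcu.mul hεu
  have h𝔭map : 𝔭.map (algebraMap A O) = maximalIdeal O :=
    IsLocalization.AtPrime.map_eq_maximalIdeal 𝔭 O
  have h𝔭fg : 𝔭.FG := (isNoetherian_def.mp inferInstance) _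
  -- (a) the ideal `(E₀ f, E₁ f)` contains `𝔭` near `𝔭`
  have h𝔞 : 𝔭.map (algebraMap A O) ≤ (Ideal.span {E 0 f, E 1 f}).map (algebraMap A O) := by
    rw [h𝔭map, Ideal.map_span, Set.image_pair, ← hD₀, ← hD₁]
    exact maximalIdeal_le_span_pair ha hμ hD₀f hD₁f
  obtain ⟨w₁, hw₁, H₁⟩ := exists_notMem_forall_not_le 𝔭 O h𝔭fg _ h𝔞
  -- (b) the ideal `(G₀, G₁)`, `G_j = f E_j u + e u E_j f`, contains `𝔭` near `𝔭`
  let G : Fin 2 → A := fun j => f * E j u + (e : A) * u * E j f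
  have hμ' : IsUnit ((e : O) * uO * (cO * εO)) := (heu.mul huu).mul hμ
  have hG0 : algebraMap A O (G 0) - (e : O) * uO * (cO * εO) * t₂ ∈ maximalIdeal O ^ 2 := by
    have h1 : algebraMap A O (G 0) = fO * D₀ uO + (e : O) * uO * D₀ fO := by
      simp only [G, map_add, map_mul, map_natCast, hD₀, hfO, huO]
    rw [h1]
    have : fO * D₀ uO + (e : O) * uO * D₀ fO - (e : O) * uO * (cO * εO) * t₂ =
        fO * D₀ uO + (e : O) * uO * (D₀ fO - cO * εO * t₂) := by ring
    rw [this]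
    exact Ideal.add_mem _ (Ideal.mul_mem_right _ _ hfO2) (Ideal.mul_mem_left _ _ hD₀f)
  have hG1 : algebraMap A O (G 1) - (e : O) * uO * (cO * εO) * t₁ ∈ maximalIdeal O ^ 2 := by
    have h1 : algebraMap A O (G 1) = fO * D₁ uO + (e : O) * uO * D₁ fO := by
      simp only [G, map_add, map_mul, map_natCast, hD₁, hfO, huO]
    rw [h1]
    have : fO * D₁ uO + (e : O) * uO * D₁ fO - (e : O) * uO * (cO * εO) * t₁ =
        fO * D₁ uO + (e : O) * uO * (D₁ fO - cO * εO * t₁) := by ring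
    rw [this]
    exact Ideal.add_mem _ (Ideal.mul_mem_right _ _ hfO2) (Ideal.mul_mem_left _ _ hD₁f)
  have h𝔟 : 𝔭.map (algebraMap A O) ≤ (Ideal.span {G 0, G 1}).map (algebraMap A O) := by
    rw [h𝔭map, Ideal.map_span, Set.image_pair]
    exact maximalIdeal_le_span_pair ha hμ' hG0 hG1
  obtain ⟨w₂, hw₂, H₂⟩ := exists_notMem_forall_not_le 𝔭 O h𝔭fg _ h𝔟
  -- the Leibniz identity `f E_j(u f^e) = f^e G_j`
  have he0 : e ≠ 0 := fun h => he (h ▸ dvd_zero p)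
  have hEs : ∀ j, f * E j (u * f ^ e) = f ^ e * G j := by
    intro j
    obtain ⟨β, hβ⟩ := Nat.exists_eq_succ_of_ne_zero he0
    rw [Nat.succ_eq_add_one] at hβ
    simp only [G]
    rw [Derivation.leibniz, Derivation.leibniz_pow, hβ, Nat.add_sub_cancel]
    simp only [smul_eq_mul, nsmul_eq_mul]
    push_cast
    ring
  refine ⟨u * w₁ * w₂, fun hmem => ?_, fun 𝔮 h𝔮 hq𝔮 hne O' _ _ _ _ _ _ => ?_⟩
  · rcases h𝔭.isPrime.mem_or_mem hmem with h1 | h1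
    · rcases h𝔭.isPrime.mem_or_mem h1 with h2 | h2
      · exact hu h2
      · exact hw₁ h2
    · exact hw₂ h1
  · have hu𝔮 : u ∉ 𝔮 := fun h1 =>
      hq𝔮 (Ideal.mul_mem_right _ _ (Ideal.mul_mem_right _ _ h1))
    have hw₁𝔮 : w₁ ∉ 𝔮 := fun h1 =>
      hq𝔮 (Ideal.mul_mem_right _ _ (Ideal.mul_mem_left _ _ h1))
    have hw₂𝔮 : w₂ ∉ 𝔮 := fun h1 => hq𝔮 (Ideal.mul_mem_left _ _ h1)
    haveI : IsLocalRing O' := inferInstance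
    by_cases hfq : f ∈ 𝔮
    · -- on `V(f)`: `f` is a regular parameter of `A_𝔮`, `x = u f^e` toroidal with `m = 1`
      obtain ⟨j, hj⟩ : ∃ j, E j f ∉ 𝔮 := by
        by_contra h2
        push Not at h2
        exact H₁ 𝔮 hw₁𝔮 hne (Ideal.span_le.mpr
          (Set.insert_subset_iff.mpr ⟨h2 0, Set.singleton_subset_iff.mpr (h2 1)⟩))
      have hfm : algebraMap A O' f ∈ maximalIdeal O' :=
        (IsLocalization.AtPrime.to_map_mem_maximal_iff O' 𝔮 f).mpr hfq
      have hfm2 : algebraMap A O' f ∉ maximalIdeal O' ^ 2 := by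
        have h := stub_leibnizObstruction (RingHom.id A) p hp 𝔮 𝔮 (Ideal.comap_id 𝔮) (E j) f hj
          (0 : O') (by rw [zero_pow hp.ne_zero, sub_zero]; exact hfm)
        rwa [zero_pow hp.ne_zero, sub_zero] at h
      obtain ⟨d', hd0', t', ht', hd', ht'0⟩ := stub_extendParameter (algebraMap A O' f) hfm hfm2
      refine Or.inl ⟨d', 1, hd0', t', fun _ => e, algebraMap A O' u,
        (IsLocalization.AtPrime.isUnit_to_map_iff O' 𝔮 u).mpr hu𝔮, ht', hd', Nat.one_pos,
        fun _ => he, ?_⟩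
      rw [hx, IsScalarTower.algebraMap_apply A O' K, map_mul, map_pow, Fin.prod_univ_one,
        show Fin.castLE hd0' (0 : Fin 1) = ⟨0, hd0'⟩ from rfl, ht'0]
    · -- off `V(f)`: regular type
      obtain ⟨j, hj⟩ : ∃ j, G j ∉ 𝔮 := by
        by_contra h2
        push Not at h2
        exact H₂ 𝔮 hw₂𝔮 hne (Ideal.span_le.mpr
          (Set.insert_subset_iff.mpr ⟨h2 0, Set.singleton_subset_iff.mpr (h2 1)⟩))
      have hfe : f ^ e ∉ 𝔮 := fun h => hfq (h𝔮.mem_of_pow_mem e h)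
      have hEs𝔮 : E j (u * f ^ e) ∉ 𝔮 := fun h2 => by
        have h3 : f ^ e * G j ∈ 𝔮 := by rw [← hEs j]; exact Ideal.mul_mem_left _ _ h2
        rcases h𝔮.mem_or_mem h3 with h4 | h4
        · exact hfe h4
        · exact hj h4
      exact Or.inr (regularType_of_derivation_apply_notMem p hp (E j) (u * f ^ e) 𝔮 hEs𝔮 x hx O')

end Summit.ResolutionOfSingularities.ResolutionOfSingularities.Theorems.RadicialJung.CleanModels

end
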